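import Literature.NumberTheory.Transcendental.GammaKummerLevels
import Literature.NumberTheory.Transcendental.GammaIsoAlgebraicStep
import HarnessLib

/-!
# Γ-isomorphisms from embeddings of `⟨K c⟩(b, exp b)`: relative Kummer theory

Toolkit for Bays–Kirby 2018, Prop. 11.2 (`Literature.NumberTheory.Transcendental.BaysKirby2018_prop_11_2`; M. Bays, J. Kirby,
*Pseudo-exponential maps, variants, and quasiminimality*, Algebra & Number Theory 12 (2018),
§3.3 good bases, Prop. 3.22; proof of Lemma 8.3). `GammaKummerLevels.lean` builds a Γ-isomorphism
`x ↦ x'` over `K` from a level-`0` embedding `K₀(x, exp x) → F` when the exponentials of the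
*whole* tuple are Kummer-independent over the level-`0` field. For the saturation step of
Prop. 11.2 one extends a *given* Γ-isomorphism `c ↦ c'` (field isomorphism
`θ : ⟨K c⟩ ≅ ⟨K c'⟩`, all division points of `exp c` already matched) by a good basis `b` of a
Γ-algebraic extension: here the natural base is the full Γ-field `E = ⟨K c⟩` and the relevant
condition is Kummer-independence of `exp b₁, …, exp bₙ` in the field `Ω = E(b, exp b)`:

* `GammaField.exists_ringHom_adjoin_roots_of_indepModPowers` — Kummer level extension over an
  arbitrary intermediate field `Ω` containing all roots of unity (`L(ⁿ√a) ≅ L[T]/(Tᵢⁿ − aᵢ)` when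
  the Kummer ideal is maximal, `Literature.FieldTheory.Kummer.isMaximal_kummerIdeal`).
* `GammaField.IsGammaIso.append_of_ringHom_adjoin` — if `τ : Ω → F` is a field embedding
  extending `θ` with `bⱼ ↦ gⱼ`, `exp bⱼ ↦ exp gⱼ`, and the `exp bⱼ` are independent modulo `m`-th
  powers in `Ω` for every `m ≥ 1`, then `(c, b) ↦ (c', g)` is a Γ-isomorphism over `K`: at level
  `M`, `τ` extends across the `M!`-th roots `exp (bⱼ/M!) ↦ exp (gⱼ/M!)`, and all level-`M`
  generators of `(c, b)` lie in `Ω(exp (b/M!))`.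

## References

* M. Bays, J. Kirby, *Pseudo-exponential maps, variants, and quasiminimality*, Algebra & Number
  Theory 12 (2018) 493–549: Def. 3.19, Prop. 3.22 (proof, case (EXP)), Lemma 8.3 (proof).
* S. Lang, *Algebra*, GTM 211, VI §8 (Kummer theory).
-/

noncomputable section

open Set MvPolynomial

namespace Literature.NumberTheory.Transcendental

namespace GammaField

open Literature.ModelTheory.ExponentialFields.ExponentialRing Literature.FieldTheory.Kummer

variable {F : Type*} [Field F] [CharZero F] [Literature.ModelTheory.ExponentialFields.ExponentialRing F]
variable {K : Submodule ℚ F} {N n : ℕ}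

/-! ### Kummer level extension over an arbitrary base -/

omit [Literature.ModelTheory.ExponentialFields.ExponentialRing F] in
/-- **Kummer level extension.** Let `Ω ≤ F` be an intermediate field (over some `k`) containing
all roots of unity of the algebraically closed `F`, `τ : Ω → F` a ring homomorphism, and
`a₁, …, aₛ ∈ Ωˣ` independent modulo `m`-th powers in `Ω` (`m ≥ 1`). Then for any `m`-th roots
`rᵢ` of `aᵢ` and `r'ᵢ` of `τ(aᵢ)` in `F`, `τ` extends to a field embedding `Ω(r) → F` with
`rᵢ ↦ r'ᵢ` (`Ω(r) ≅ Ω[T]/(Tᵢᵐ − aᵢ)`, the Kummer ideal being maximal).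
[cite: Lang2002, VI §8 (Thm 8.1)] -/
theorem exists_ringHom_adjoin_roots_of_indepModPowers [IsAlgClosed F] {k : Type*} [Field k]
    [Algebra k F] (Ω : IntermediateField k F)
    (hroots : ∀ (m : ℕ), 0 < m → ∀ ζ : F, ζ ^ m = 1 → ζ ∈ Ω)
    (τ : Ω →+* F) {m : ℕ} (hm : 0 < m) {s : ℕ} (a : Fin s → Ω) (ha : ∀ i, a i ≠ 0)
    (hind : IndepModPowers m a) (r r' : Fin s → F) (hr : ∀ i, r i ^ m = (a i : F))
    (hr' : ∀ i, r' i ^ m = τ (a i)) :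
    ∃ ψ : IntermediateField.adjoin Ω (range r) →+* F,
      (∀ z : Ω, ψ (algebraMap Ω _ z) = τ z) ∧
      ∀ i, ψ ⟨r i, IntermediateField.subset_adjoin _ _ (mem_range_self i)⟩ = r' i := by
  haveI : NeZero m := ⟨hm.ne'⟩
  haveI : NeZero (m : F) := ⟨Nat.cast_ne_zero.2 hm.ne'⟩
  -- roots of unity in `Ω`
  obtain ⟨ζ, hζ⟩ := HasEnoughRootsOfUnity.exists_primitiveRoot F m
  have hζΩ : ζ ∈ Ω := hroots m hm ζ hζ.pow_eq_one
  obtain ⟨i₀, hi₀⟩ := IsAlgClosed.exists_pow_nat_eq (-1 : F) (by norm_num : 0 < 2)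
  have hi₀Ω : i₀ ∈ Ω := hroots 4 (by norm_num) i₀
    (by rw [show (4 : ℕ) = 2 * 2 from rfl, pow_mul, hi₀]; norm_num)
  let ζ' : Ω := ⟨ζ, hζΩ⟩
  have hζ' : IsPrimitiveRoot ζ' m :=
    IsPrimitiveRoot.of_map_of_injective (f := algebraMap Ω F) (by exact hζ) (algebraMap Ω F).injective
  have hi' : ∃ i : Ω, i ^ 2 = -1 := ⟨⟨i₀, hi₀Ω⟩, Subtype.ext (by simpa using hi₀)⟩
  have hmax : (kummerIdeal m a).IsMaximal := isMaximal_kummerIdeal hζ' hi' a ha hind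
  have hk1 : RingHom.ker (eval₂Hom (algebraMap Ω F) r) = kummerIdeal m a :=
    ker_eval₂Hom_eq_kummerIdeal _ _ r (fun i => by rw [hr i]; rfl) hmax
  have hk2 : RingHom.ker (eval₂Hom τ r') = kummerIdeal m a :=
    ker_eval₂Hom_eq_kummerIdeal τ _ r' hr' hmax
  have hiff : ∀ p : MvPolynomial (Fin s) Ω, aeval r p = 0 ↔ eval₂ τ r' p = 0 := by
    intro p
    have h1 : aeval r p = 0 ↔ p ∈ kummerIdeal m a := by
      rw [← hk1, RingHom.mem_ker]; rfl
    have h2 : eval₂ τ r' p = 0 ↔ p ∈ kummerIdeal m a := by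
      rw [← hk2, RingHom.mem_ker]; rfl
    exact h1.trans h2.symm
  exact ⟨pointFieldHom τ r r' hiff, pointFieldHom_algebraMap τ r r' hiff,
    pointFieldHom_apply_self τ r r' hiff⟩

/-- All roots of unity of `F` lie in the Γ-field `⟨K c⟩` of a Γ-closed `K`. [folklore] -/
theorem mem_adjoinField_allGens_of_pow_eq_one (hK : IsGammaClosed K) (c : Fin N → F) {m : ℕ}
    (hm : 0 < m) {ζ : F} (hζ : ζ ^ m = 1) :
    ζ ∈ IntermediateField.adjoin (fieldOf K) (allGens c) :=
  mem_adjoinField_of_mem_sup (Submodule.mem_sup_left (hK.mem_of_pow_eq_one hm hζ))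

/-! ### Γ-isomorphisms from embeddings of `⟨K c⟩(b, exp b)` -/

/-- The level-`M` generators of `(c, b)` lie in `⟨K c⟩(b, exp b)(exp (b/M!))`; here
`⟨K c⟩(b, exp b)` is the field `K₀(allGens c, b, exp b)`. [folklore] -/
theorem lvGens_append_mem_adjoin_roots (M : ℕ) (c : Fin N → F) (b : Fin n → F)
    (s : Fin (N + n) ⊕ Fin (N + n)) :
    lvGens M (Fin.append c b) s ∈
      IntermediateField.adjoin (IntermediateField.adjoin (fieldOf K) (allGens c ∪ range (gammaPt b)))
        (range fun j : Fin n => exp (b j / (M.factorial : F))) := by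
  have hΩ : ∀ z : F, z ∈ IntermediateField.adjoin (fieldOf K) (allGens c ∪ range (gammaPt b)) →
      z ∈ IntermediateField.adjoin (IntermediateField.adjoin (fieldOf K) (allGens c ∪ range (gammaPt b)))
        (range fun j : Fin n => exp (b j / (M.factorial : F))) := fun z hz =>
    IntermediateField.algebraMap_mem _
      (⟨z, hz⟩ : IntermediateField.adjoin (fieldOf K) (allGens c ∪ range (gammaPt b)))
  rcases s with s | s
  · refine Fin.addCases (fun i => ?_) (fun j => ?_) s
    · rw [lvGens_inl, Fin.append_left]
      refine hΩ _ (IntermediateField.subset_adjoin _ _ (Or.inl ?_))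
      exact mem_iUnion.2 ⟨0, Sum.inl i, rfl⟩
    · rw [lvGens_inl, Fin.append_right]
      exact hΩ _ (IntermediateField.subset_adjoin _ _ (Or.inr ⟨Sum.inl j, rfl⟩))
  · refine Fin.addCases (fun i => ?_) (fun j => ?_) s
    · rw [lvGens_inr, Fin.append_left]
      refine hΩ _ (IntermediateField.subset_adjoin _ _ (Or.inl ?_))
      exact mem_iUnion.2 ⟨M, Sum.inr i, rfl⟩
    · rw [lvGens_inr, Fin.append_right]
      exact IntermediateField.subset_adjoin _ _ ⟨j, rfl⟩

/-- `⟨K c⟩ ≤ ⟨K c⟩(b, exp b)`. [folklore] -/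
theorem adjoinField_le_adjoin_union (c : Fin N → F) (b : Fin n → F) :
    IntermediateField.adjoin (fieldOf K) (allGens c) ≤
      IntermediateField.adjoin (fieldOf K) (allGens c ∪ range (gammaPt b)) :=
  IntermediateField.adjoin.mono _ _ _ subset_union_left

/-- **Γ-isomorphisms from embeddings of `⟨K c⟩(b, exp b)`** (Bays–Kirby 2018, Prop. 3.22 /
Def. 3.19: the isomorphism type of the extension generated by a good basis is determined at
level `0`, relative to the base Γ-field). Let `K` be Γ-closed in the algebraically closed `F`,
`c ↦ c'` a Γ-isomorphism over `K` with field isomorphism `θ : ⟨K c⟩ ≅ ⟨K c'⟩`, and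
`τ : ⟨K c⟩(b, exp b) = K₀(allGens c, b, exp b) → F` a ring homomorphism extending `θ` with
`bⱼ ↦ gⱼ`, `exp bⱼ ↦ exp gⱼ`. If `exp b₁, …, exp bₙ` are independent modulo `m`-th powers in
`⟨K c⟩(b, exp b)` for all `m ≥ 1`, then `(c, b) ↦ (c', g)` is a Γ-isomorphism over `K`.
[cite: BaysKirby2018ANT, Prop. 3.22 (proof, case (EXP)), Def. 3.19, Lemma 8.3 (proof)] -/
theorem IsGammaIso.append_of_ringHom_adjoin [IsAlgClosed F] (hK : IsGammaClosed K)
    {c c' : Fin N → F} (h : IsGammaIso K c c') {b g : Fin n → F}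
    (τ : IntermediateField.adjoin (fieldOf K) (allGens c ∪ range (gammaPt b)) →+* F)
    (hτE : ∀ (z : F) (hz : z ∈ IntermediateField.adjoin (fieldOf K) (allGens c)),
      τ ⟨z, adjoinField_le_adjoin_union c b hz⟩ = (h.fieldEquiv ⟨z, hz⟩ : F))
    (hτb : ∀ j, τ ⟨b j, IntermediateField.subset_adjoin _ _ (Or.inr ⟨Sum.inl j, rfl⟩)⟩ = g j)
    (hτe : ∀ j, τ ⟨exp (b j), IntermediateField.subset_adjoin _ _ (Or.inr ⟨Sum.inr j, rfl⟩)⟩ = exp (g j))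
    (hind : ∀ m, 0 < m → IndepModPowers m (fun j =>
      (⟨exp (b j), IntermediateField.subset_adjoin _ _ (Or.inr ⟨Sum.inr j, rfl⟩)⟩ :
        IntermediateField.adjoin (fieldOf K) (allGens c ∪ range (gammaPt b))))) :
    IsGammaIso K (Fin.append c b) (Fin.append c' g) := by
  classical
  rw [isGammaIso_iff_ker_eq]
  intro M
  have hmpos : 0 < M.factorial := Nat.factorial_pos M
  have hroots : ∀ (m : ℕ), 0 < m → ∀ ζ : F, ζ ^ m = 1 →
      ζ ∈ IntermediateField.adjoin (fieldOf K) (allGens c ∪ range (gammaPt b)) :=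
    fun m hm ζ hζ => adjoinField_le_adjoin_union c b (mem_adjoinField_allGens_of_pow_eq_one hK c hm hζ)
  obtain ⟨ψ, hψΩ, hψr⟩ := exists_ringHom_adjoin_roots_of_indepModPowers _ hroots τ hmpos _
    (fun j h0 => exp_ne_zero (b j) (congrArg Subtype.val h0)) (hind _ hmpos)
    (fun j => exp (b j / (M.factorial : F))) (fun j => exp (g j / (M.factorial : F)))
    (fun j => exp_div_factorial_pow (b j) M)
    (fun j => by rw [hτe]; exact exp_div_factorial_pow (g j) M)
  -- membership of the level-`M` generators in `Ω(r)` and their images under `ψ`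
  have hmem : ∀ s, lvGens M (Fin.append c b) s ∈
      IntermediateField.adjoin (IntermediateField.adjoin (fieldOf K) (allGens c ∪ range (gammaPt b)))
        (range fun j : Fin n => exp (b j / (M.factorial : F))) := lvGens_append_mem_adjoin_roots (K := K) M c b
  have hΩmem : ∀ z : IntermediateField.adjoin (fieldOf K) (allGens c ∪ range (gammaPt b)), (z : F) ∈
      IntermediateField.adjoin (IntermediateField.adjoin (fieldOf K) (allGens c ∪ range (gammaPt b)))
        (range fun j : Fin n => exp (b j / (M.factorial : F))) := fun z => IntermediateField.algebraMap_mem _ z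
  have hψΩ' : ∀ z : IntermediateField.adjoin (fieldOf K) (allGens c ∪ range (gammaPt b)),
      ψ ⟨z, hΩmem z⟩ = τ z := fun z => hψΩ z
  have hψE : ∀ (z : F) (hz : z ∈ IntermediateField.adjoin (fieldOf K) (allGens c)),
      ψ ⟨z, hΩmem ⟨z, adjoinField_le_adjoin_union c b hz⟩⟩ = (h.fieldEquiv ⟨z, hz⟩ : F) := fun z hz => by
    rw [hψΩ' ⟨z, adjoinField_le_adjoin_union c b hz⟩, hτE z hz]
  have hψval : ∀ s, ψ ⟨lvGens M (Fin.append c b) s, hmem s⟩ = lvGens M (Fin.append c' g) s := by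
    rintro (s | s)
    · refine Fin.addCases (fun i => ?_) (fun j => ?_) s
      · have hci : c i ∈ IntermediateField.adjoin (fieldOf K) (allGens c) :=
          IntermediateField.subset_adjoin _ _ (mem_iUnion.2 ⟨0, Sum.inl i, rfl⟩)
        have e1 : (⟨lvGens M (Fin.append c b) (Sum.inl (Fin.castAdd n i)), hmem _⟩ :
            IntermediateField.adjoin (IntermediateField.adjoin (fieldOf K) (allGens c ∪ range (gammaPt b)))
              (range fun j : Fin n => exp (b j / (M.factorial : F)))) =
            ⟨c i, hΩmem ⟨c i, adjoinField_le_adjoin_union c b hci⟩⟩ := Subtype.ext (by simp [lvGens])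
        rw [e1, hψE (c i) hci, lvGens_inl, Fin.append_left]
        have := h.coe_fieldEquiv_lvGens 0 (Sum.inl i)
        simpa only [lvGens_inl] using this
      · have e1 : (⟨lvGens M (Fin.append c b) (Sum.inl (Fin.natAdd N j)), hmem _⟩ :
            IntermediateField.adjoin (IntermediateField.adjoin (fieldOf K) (allGens c ∪ range (gammaPt b)))
              (range fun j : Fin n => exp (b j / (M.factorial : F)))) =
            ⟨b j, hΩmem ⟨b j, IntermediateField.subset_adjoin _ _ (Or.inr ⟨Sum.inl j, rfl⟩)⟩⟩ :=
          Subtype.ext (by simp [lvGens])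
        rw [e1, hψΩ' ⟨b j, IntermediateField.subset_adjoin _ _ (Or.inr ⟨Sum.inl j, rfl⟩)⟩, hτb, lvGens_inl,
          Fin.append_right]
    · refine Fin.addCases (fun i => ?_) (fun j => ?_) s
      · have hci : exp (c i / (M.factorial : F)) ∈ IntermediateField.adjoin (fieldOf K) (allGens c) :=
          IntermediateField.subset_adjoin _ _ (mem_iUnion.2 ⟨M, Sum.inr i, rfl⟩)
        have e1 : (⟨lvGens M (Fin.append c b) (Sum.inr (Fin.castAdd n i)), hmem _⟩ :
            IntermediateField.adjoin (IntermediateField.adjoin (fieldOf K) (allGens c ∪ range (gammaPt b)))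
              (range fun j : Fin n => exp (b j / (M.factorial : F)))) =
            ⟨exp (c i / (M.factorial : F)), hΩmem ⟨_, adjoinField_le_adjoin_union c b hci⟩⟩ :=
          Subtype.ext (by simp [lvGens])
        rw [e1, hψE _ hci, lvGens_inr, Fin.append_left]
        have := h.coe_fieldEquiv_lvGens M (Sum.inr i)
        simpa only [lvGens_inr] using this
      · have e1 : (⟨lvGens M (Fin.append c b) (Sum.inr (Fin.natAdd N j)), hmem _⟩ :
            IntermediateField.adjoin (IntermediateField.adjoin (fieldOf K) (allGens c ∪ range (gammaPt b)))
              (range fun j : Fin n => exp (b j / (M.factorial : F)))) =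
            ⟨exp (b j / (M.factorial : F)), IntermediateField.subset_adjoin _ _ (mem_range_self j)⟩ :=
          Subtype.ext (by simp [lvGens])
        rw [e1, hψr j, lvGens_inr, Fin.append_right]
  -- `ψ` is the identity on `K₀`
  have hKmem : ∀ k : fieldOf K, (k : F) ∈ IntermediateField.adjoin (fieldOf K) (allGens c) := fun k =>
    IntermediateField.algebraMap_mem _ k
  have hψK : ∀ k : fieldOf K, ψ ⟨k, hΩmem ⟨k, adjoinField_le_adjoin_union c b (hKmem k)⟩⟩ = k := fun k => by
    rw [hψE (k : F) (hKmem k)]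
    exact h.coe_fieldEquiv_algebraMap k
  -- evaluation inside `Ω(r)`
  let ιK : fieldOf K →+* IntermediateField.adjoin
      (IntermediateField.adjoin (fieldOf K) (allGens c ∪ range (gammaPt b)))
      (range fun j : Fin n => exp (b j / (M.factorial : F))) :=
    (algebraMap (IntermediateField.adjoin (fieldOf K) (allGens c ∪ range (gammaPt b))) _).comp
      (algebraMap (fieldOf K) (IntermediateField.adjoin (fieldOf K) (allGens c ∪ range (gammaPt b))))
  have hιK : ∀ k : fieldOf K, ιK k = ⟨k, hΩmem ⟨k, adjoinField_le_adjoin_union c b (hKmem k)⟩⟩ := fun k => rfl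
  let gv : Fin (N + n) ⊕ Fin (N + n) → IntermediateField.adjoin
      (IntermediateField.adjoin (fieldOf K) (allGens c ∪ range (gammaPt b)))
      (range fun j : Fin n => exp (b j / (M.factorial : F))) := fun s => ⟨lvGens M (Fin.append c b) s, hmem s⟩
  have key : ∀ P : MvPolynomial (Fin (N + n) ⊕ Fin (N + n)) (fieldOf K),
      ((eval₂ ιK gv P : IntermediateField.adjoin
        (IntermediateField.adjoin (fieldOf K) (allGens c ∪ range (gammaPt b)))
        (range fun j : Fin n => exp (b j / (M.factorial : F)))) : F) = aeval (lvGens M (Fin.append c b)) P ∧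
      ψ (eval₂ ιK gv P) = aeval (lvGens M (Fin.append c' g)) P := by
    intro P
    constructor
    · rw [show ((eval₂ ιK gv P : IntermediateField.adjoin
          (IntermediateField.adjoin (fieldOf K) (allGens c ∪ range (gammaPt b)))
          (range fun j : Fin n => exp (b j / (M.factorial : F)))) : F) = (algebraMap _ F) (eval₂ ιK gv P) from rfl,
        eval₂_comp_left, aeval_def]
      rfl
    · rw [eval₂_comp_left, aeval_def]
      congr 1
      · ext k; rw [RingHom.comp_apply, hιK]; exact hψK k
      · funext s; exact hψval s
  ext P
  rw [RingHom.mem_ker, RingHom.mem_ker]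
  change aeval (lvGens M (Fin.append c b)) P = 0 ↔ aeval (lvGens M (Fin.append c' g)) P = 0
  rw [← (key P).1, ← (key P).2]
  constructor
  · intro h0
    have : eval₂ ιK gv P = 0 := Subtype.ext h0
    rw [this, map_zero]
  · intro h0
    have : eval₂ ιK gv P = 0 := (injective_iff_map_eq_zero ψ).1 ψ.injective _ h0
    rw [this]; rfl

end GammaField

end Literature.NumberTheory.Transcendental
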